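import Mathlib
import HarnessLib
import Summits.PneNP.PneNP.Theses.KrwChromaticSteering
import Summits.PneNP.PneNP.Theorems.KrwChromaticSteeringCompositionIteration
import Summits.PneNP.PneNP.Theorems.KrwChromaticSteeringCompositionIterationFrac
import Summits.PneNP.PneNP.Cruxes.StrongComposition.Disproof

/-!
# Crux `StrongComposition` (stmt-PneNP-18538) — weak KRW for EASY outer functions already gives `P ⊄ NC¹`
(embed seat pnp-ideate-p5, g5; support for the door family of cards `inner-fraction-door` / `easy-outer-door`
 and for the host chain of `SliceSemiMonotone.lean`)

The KRW tower `h_{j+1} = h_j ⋄ g_{j+1}` (inner arity `k = 2^t`, `h` row-major on `k^{j+1}` bits) only ever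
composes with OUTER functions that are polynomially easy for their arity — provided the tower is started at an
easy function.  Starting it at the DICTATOR `x ↦ x₀` on `k` bits (KW depth `0`) instead of at a hard `k`-bit
function makes EVERY level's outer function easy in the sense of card `easy-outer-door`
(`EasyOuter f`: some `KW_f` protocol of depth `D` with `D² ≤ 4m(⌊log₂ m⌋+1)²`): at level `j ≥ 1` the outer
function lives on `m = k^{j+1}` bits and has a protocol of depth `≤ j(k + ⌊log₂ k⌋ + 2) ≤ 2jk`, and
`(2jk)² ≤ 4·k^{j+1}·(⌊log₂ k^{j+1}⌋+1)²` (`easyOuter_of_depth_le`).  Nothing is lost: the dictator start costs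
one level of gain, absorbed by the parameters.  Consequently

* `notNC1_of_easyOuterWeakKRWFrac : EasyOuterWeakKRWFrac → ∃ L ∈ P, L ∉ NC¹` — the weak KRW conjecture
  (depth form, inner term at ANY constant fraction, loss `O(log mn)`) is needed ONLY for polynomially easy
  outer functions (PROVED here, sorry-free; the endgame `not_NC1_of_hardFunctions` and `WeakKRWFrac` are IMPORTED
  from the landed `Theorems/KrwChromaticSteeringCompositionIterationFrac.lean`, p615650 — FILE B of this seat,
  landed by pnp-ideate-prover-2);
* `compositionIterationSplit_holds` — the unproved first lemma `CompositionIterationSplit` of card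
  `easy-outer-door` (`Cruxes/StrongComposition/EasyOuterDoorSketch.lean`, verbatim statement) HOLDS, and in
  fact WITHOUT its first and third antecedents: neither Meir's theorem (the "one hard level"
  `HardSmallOuterFrac`) nor `FormulaHardFunctionsExist` is needed — `closes_easy'` below takes only
  `EasyOuterFrac`, `StandardFromStrong` (C2) and the residual `FormulaLayerLift`;
* for the embed host (`SliceSemiMonotone.lean` v5/v6): dRMNPR's Conjecture 2 is likewise needed only for easy
  outer `f` (and one slice inner function per arity).

Honest framing: CONDITIONAL glue — `EasyOuterWeakKRWFrac` / `EasyOuterFrac` are open conjectures (doors below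
the crux); `P ≠ NP` is not proved and nothing here bears on P vs NP beyond the printed KRW implication.
FRONTIER.
-/

set_option autoImplicit false
set_option linter.dupNamespace false

namespace Summit.PneNP.PneNP.Cruxes.StrongComposition.EasyOuterIterationFrac

open Literature.Computability.Complexity
open Summit.PneNP.PneNP.Theorems.KrwCompositionIteration
open Summit.PneNP.PneNP.Theorems.KrwChromaticSteeringCompositionIterationFrac
  (WeakKRWFrac not_NC1_of_hardFunctions)

/-! ### Statements -/

/-- VERBATIM `EasyOuterDoor.EasyOuter`: `f` is polynomially easy — some `KW_f` protocol has depth `D` with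
`D² ≤ 4·m·(⌊log₂ m⌋+1)²`. -/
def EasyOuter {m : ℕ} (f : (Fin m → Bool) → Bool) : Prop :=
  ∃ Q₀ : KWTree (Fin m), Q₀.Solves f ∧ Q₀.depth * Q₀.depth ≤ 4 * m * (Nat.log 2 m + 1) ^ 2

/-- **Weak KRW for easy outer functions** (standard composition game, depth form, inner term at a constant
fraction `1/k`, loss `c·(⌊log₂(mn)⌋+1)`), demanded ONLY for polynomially easy non-constant outer `f`. OPEN. -/
def EasyOuterWeakKRWFrac : Prop :=
  ∃ c k : ℕ, 0 < k ∧ ∀ m n : ℕ, 1 ≤ n → ∀ f : (Fin m → Bool) → Bool, (∃ a b, f a ≠ f b) →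
    EasyOuter f →
    ∃ g : (Fin n → Bool) → Bool, ∀ P : KWTree (Fin m × Fin n), P.Solves (blockComp f g) →
      ∃ Q : KWTree (Fin m), Q.Solves f ∧ Q.depth + n / k ≤ P.depth + c * (Nat.log 2 (m * n) + 1)

/-- Weak KRW at fractional scale for ALL outer functions (the landed `WeakKRWFrac` of
`Theorems/KrwChromaticSteeringCompositionIterationFrac.lean`) implies the easy-outer form. -/
theorem easyOuterWeakKRWFrac_of_weakKRWFrac (h : WeakKRWFrac) : EasyOuterWeakKRWFrac := by
  obtain ⟨c, k, hk, hc⟩ := h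
  exact ⟨c, k, hk, fun m n hn f hf _ => hc m n hn f hf⟩

/-! ### Arithmetic of "easy" along the tower -/

theorem add_two_le_two_pow {x : ℕ} (hx : 2 ≤ x) : x + 2 ≤ 2 ^ x := by
  induction x, hx using Nat.le_induction with
  | base => norm_num
  | succ n hn ih => rw [pow_succ]; omega

theorem two_le_of_succ_lt_two_pow {t : ℕ} (h : t + 1 < 2 ^ t) : 2 ≤ t := by
  rcases t with _ | _ | t
  · simp at h
  · simp at h
  · omega

theorem log_add_two_le {k : ℕ} (hk : 4 ≤ k) : Nat.log 2 k + 2 ≤ k := by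
  have h2 : 2 ≤ Nat.log 2 k := Nat.le_log_of_pow_le (by norm_num) (by simpa using hk)
  exact (add_two_le_two_pow h2).trans (Nat.pow_log_le_self 2 (by omega))

/-- The tower's outer functions are easy: on `N = k^(j+1)` bits (`k ≥ 4`) a protocol of depth
`≤ j·(k + ⌊log₂ k⌋ + 2)` witnesses `EasyOuter`. -/
theorem easyOuter_of_depth_le {k j N : ℕ} (hk : 4 ≤ k) (hN : N = k ^ (j + 1))
    {h : (Fin N → Bool) → Bool} {Q₀ : KWTree (Fin N)} (hQ₀ : Q₀.Solves h)
    (hd : Q₀.depth ≤ j * (k + Nat.log 2 k + 2)) : EasyOuter h := by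
  refine ⟨Q₀, hQ₀, ?_⟩
  rcases Nat.eq_zero_or_pos j with rfl | hj
  · have h0 : Q₀.depth = 0 := by omega
    simp [h0]
  · have hU : k + Nat.log 2 k + 2 ≤ 2 * k := by have := log_add_two_le hk; omega
    have hD : Q₀.depth ≤ j * (2 * k) := hd.trans (Nat.mul_le_mul_left j hU)
    have hk2 : k * k ≤ N := by
      rw [hN, ← sq]; exact Nat.pow_le_pow_right (by omega) (by omega)
    have hjlog : j + 1 ≤ Nat.log 2 N := by
      refine Nat.le_log_of_pow_le (by norm_num) ?_
      rw [hN]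
      exact Nat.pow_le_pow_left (by omega) _
    have hjj : j * j ≤ (Nat.log 2 N + 1) ^ 2 := by
      rw [sq]; exact Nat.mul_le_mul (by omega) (by omega)
    calc Q₀.depth * Q₀.depth ≤ (j * (2 * k)) * (j * (2 * k)) := Nat.mul_le_mul hD hD
      _ = 4 * (k * k) * (j * j) := by ring
      _ ≤ 4 * N * (Nat.log 2 N + 1) ^ 2 := Nat.mul_le_mul (Nat.mul_le_mul_left 4 hk2) hjj

/-! ### Row-major transport (matrix protocol ⟹ row-major protocol) -/

theorem exists_solves_rowMajor_of_blockComp {m n : ℕ} (h : (Fin m → Bool) → Bool)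
    (g : (Fin n → Bool) → Bool) (P : KWTree (Fin m × Fin n)) (hP : P.Solves (blockComp h g)) :
    ∃ Q : KWTree (Fin (m * n)), (Q.Solves fun x => blockComp h g fun p => x (finProdFinEquiv p)) ∧
      Q.depth = P.depth := by
  refine ⟨P.comap (fun x p => x (finProdFinEquiv p)) (fun x p => x (finProdFinEquiv p))
    (fun p => finProdFinEquiv p), ?_, KWTree.depth_comap _ _ _ P⟩
  exact solves_comap_of_embedding hP _ _ (fun x => rfl) (fun x y p hp => hp)

/-! ### The tower started at the dictator -/

/-- **The KRW iteration from an EASY start, fractional gain.** Under weak KRW for easy outer functions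
(constants `c`, `K`), inner arity `k ≥ 4` and `d` levels with `c·(d+1)·(⌊log₂ k⌋+1) < k / K`: every `j ≤ d` has
a non-constant `h_j` on `k^{j+1}` bits with (LB) every `KW_{h_j}` protocol of depth
`≥ j·(k/K) − j·c·(d+1)·(⌊log₂ k⌋+1)`, (UB) some `KW_{h_j}` protocol of depth `≤ j·(k + ⌊log₂ k⌋ + 2)` — so `h_j`
is EASY as an outer function for the next level — and a `B₂`-program of `≤ (j+1)·k^{j+1}·univBound k` gates.
Level `0` is the dictator `x ↦ x₀` on `k` bits. -/
theorem iterate_levels_easy {c K : ℕ}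
    (hweak : ∀ m n : ℕ, 1 ≤ n → ∀ f : (Fin m → Bool) → Bool, (∃ a b, f a ≠ f b) → EasyOuter f →
      ∃ g : (Fin n → Bool) → Bool, ∀ P : KWTree (Fin m × Fin n), P.Solves (blockComp f g) →
        ∃ Q : KWTree (Fin m), Q.Solves f ∧ Q.depth + n / K ≤ P.depth + c * (Nat.log 2 (m * n) + 1))
    {k d : ℕ} (hk : 4 ≤ k) (hB : c * ((d + 1) * (Nat.log 2 k + 1)) < k / K) :
    ∀ j : ℕ, j ≤ d → ∃ N : ℕ, N = k ^ (j + 1) ∧ ∃ h : (Fin N → Bool) → Bool,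
      (∃ a b, h a ≠ h b) ∧
      (∀ Q : KWTree (Fin N), Q.Solves h →
        j * (k / K) ≤ Q.depth + j * (c * ((d + 1) * (Nat.log 2 k + 1)))) ∧
      (∃ Q₀ : KWTree (Fin N), Q₀.Solves h ∧ Q₀.depth ≤ j * (k + Nat.log 2 k + 2)) ∧
      CktSize B2 (fun x (_ : Unit) => h x) ((j + 1) * (N * univBound k))
  | 0, _ => by
    have hk0 : 0 < k := by omega
    refine ⟨k, (pow_one k).symm, fun x => x ⟨0, hk0⟩, ⟨fun _ => true, fun _ => false, by simp⟩,
      fun Q _ => by simp, ⟨KWTree.leaf ⟨0, hk0⟩, fun a b ha hb => ?_, by simp⟩, ?_⟩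
    · simp only [KWTree.run_leaf, ne_eq]
      simp only at ha hb
      rw [ha, hb]
      decide
    · exact (CktSize.proj B2 (fun _ : Unit => (⟨0, hk0⟩ : Fin k))).of_le (Nat.zero_le _)
  | j + 1, hj => by
    obtain ⟨N, hN, h, hnc, hlb, ⟨Q₀, hQ₀, hQ₀d⟩, hck⟩ :=
      iterate_levels_easy hweak hk hB j (Nat.le_of_succ_le hj)
    have hk0 : 0 < k := by omega
    have hk1 : 1 ≤ k := hk0
    have hEasy : EasyOuter h := easyOuter_of_depth_le hk hN hQ₀ hQ₀d
    obtain ⟨g, hg⟩ := hweak N k hk1 h hnc hEasy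
    -- per-level loss: `c (⌊log₂ (N k)⌋ + 1) ≤ c (d+1) (⌊log₂ k⌋ + 1)` (`N k = k^(j+2)`, `j + 2 ≤ d + 1`)
    have hloss : c * (Nat.log 2 (N * k) + 1) ≤ c * ((d + 1) * (Nat.log 2 k + 1)) := by
      refine Nat.mul_le_mul_left c ?_
      rw [hN, ← pow_succ]
      exact (log_pow_succ_le k (j + 1)).trans (Nat.mul_le_mul_right _ (by omega))
    -- (LB) for the new function `h' = h ⋄ g`, row-major on `N * k` bits
    have hlb' : ∀ Q : KWTree (Fin (N * k)),
        Q.Solves (fun x => blockComp h g fun p => x (finProdFinEquiv p)) →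
          (j + 1) * (k / K) ≤ Q.depth + (j + 1) * (c * ((d + 1) * (Nat.log 2 k + 1))) := by
      intro Q hQ
      obtain ⟨P, hP, hPd⟩ := exists_solves_blockComp_of_rowMajor h g Q hQ
      obtain ⟨Q₁, hQ₁, hd⟩ := hg P hP
      have ih := hlb Q₁ hQ₁
      rw [hPd] at hd
      rw [Nat.succ_mul, Nat.succ_mul]
      generalize k / K = q at ih hd ⊢
      generalize c * ((d + 1) * (Nat.log 2 k + 1)) = B at ih hloss ⊢
      generalize c * (Nat.log 2 (N * k) + 1) = B' at hd hloss
      generalize j * q = jq at ih ⊢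
      generalize j * B = jB at ih ⊢
      omega
    -- non-constancy of `h'` (from (LB) at a leaf and `hB`)
    have hnc' : ∃ a b, (fun x : Fin (N * k) → Bool => blockComp h g fun p => x (finProdFinEquiv p)) a ≠
        (fun x : Fin (N * k) → Bool => blockComp h g fun p => x (finProdFinEquiv p)) b := by
      by_contra hall
      have hNk : 0 < N * k := by
        rw [hN, ← pow_succ]; exact Nat.pow_pos hk0
      have hsol := solves_of_forall_eq (KWTree.leaf (⟨0, hNk⟩ : Fin (N * k)))
        (h := fun x : Fin (N * k) → Bool => blockComp h g fun p => x (finProdFinEquiv p))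
        (fun a b => by by_contra hab; exact hall ⟨a, b, hab⟩)
      have h1 := hlb' _ hsol
      rw [KWTree.depth_leaf, zero_add] at h1
      have h2 : k / K ≤ c * ((d + 1) * (Nat.log 2 k + 1)) :=
        Nat.le_of_mul_le_mul_left h1 (Nat.succ_pos j)
      omega
    -- (UB) the obvious protocol: `Q₀` on the labels, then "send your row"
    have hub' : ∃ Q₀' : KWTree (Fin (N * k)),
        (Q₀'.Solves fun x => blockComp h g fun p => x (finProdFinEquiv p)) ∧
          Q₀'.depth ≤ (j + 1) * (k + Nat.log 2 k + 2) := by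
      obtain ⟨R, hR, hRd⟩ := Disproof.exists_solves_sendInput hk1 g
      obtain ⟨Q', hQ', hQ'd⟩ := exists_solves_rowMajor_of_blockComp h g (KWTree.compose g R Q₀)
        (KWTree.solvesStrong_compose hQ₀ hR).solves
      refine ⟨Q', hQ', ?_⟩
      rw [hQ'd, KWTree.depth_compose, Nat.succ_mul]
      omega
    refine ⟨N * k, by rw [hN, ← pow_succ], _, hnc', hlb', hub', ?_⟩
    refine (cktSize_blockComp_rowMajor g hck).of_le ?_
    have hNU : N * univBound k ≤ N * k * univBound k :=
      Nat.mul_le_mul_right _ (Nat.le_mul_of_pos_right N hk0)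
    calc N * univBound k + (j + 1) * (N * univBound k) = (j + 1 + 1) * (N * univBound k) := by ring
      _ ≤ (j + 1 + 1) * (N * k * univBound k) := Nat.mul_le_mul_left _ hNU

/-- **A hard function with a small circuit, from weak KRW for EASY outer functions.**  For every `c₀` there
are `N ≥ 1`, `h : {0,1}^N → {0,1}`, a `B₂`-circuit `C` computing `h` and `S ≥ 1` with `⌊log₂(N + |C|)⌋ ≤ 4 S`
such that every protocol for `KW_h` has depth `> c₀ · S`.  Parameters: `d = K (c₀ + 1)` levels above the
dictator, `E = d + 1`, inner arity `k = 2^t` with `((c₀+1) K + c E² + c₀ E + 1)(t+1) < 2^t` (so `t ≥ 2`,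
`k ≥ 4`), `S = k + E (t+1)`, `N = k^E`. -/
theorem exists_hard_function_of_easyOuterWeakKRWFrac {c K : ℕ}
    (hweak : ∀ m n : ℕ, 1 ≤ n → ∀ f : (Fin m → Bool) → Bool, (∃ a b, f a ≠ f b) → EasyOuter f →
      ∃ g : (Fin n → Bool) → Bool, ∀ P : KWTree (Fin m × Fin n), P.Solves (blockComp f g) →
        ∃ Q : KWTree (Fin m), Q.Solves f ∧ Q.depth + n / K ≤ P.depth + c * (Nat.log 2 (m * n) + 1))
    (hK : 0 < K) (c₀ : ℕ) :
    ∃ N : ℕ, 1 ≤ N ∧ ∃ h : (Fin N → Bool) → Bool, ∃ C : Circuit (Fin N),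
      C.IsOver B2 ∧ C.Computes h ∧ ∃ S : ℕ, 1 ≤ S ∧ Nat.log 2 (N + C.size) ≤ 4 * S ∧
        ∀ P : KWTree (Fin N), P.Solves h → c₀ * S < P.depth := by
  set d : ℕ := K * (c₀ + 1) with hd
  set E : ℕ := d + 1 with hE
  have hKd : K ≤ d := by rw [hd]; exact Nat.le_mul_of_pos_right K (Nat.succ_pos c₀)
  have hKE : K ≤ E := hKd.trans (Nat.le_succ d)
  obtain ⟨t, ht⟩ := exists_mul_succ_lt_two_pow ((c₀ + 1) * K + c * (E * E) + c₀ * E + 1)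
  set k : ℕ := 2 ^ t with hkdef
  have hlog : Nat.log 2 k = t := Nat.log_pow (by norm_num) t
  -- `t ≥ 2`, hence `k ≥ 4`
  have ht2 : 2 ≤ t := by
    have hge : t + 1 ≤ ((c₀ + 1) * K + c * (E * E) + c₀ * E + 1) * (t + 1) :=
      Nat.le_mul_of_pos_left (t + 1) (Nat.succ_pos _)
    exact two_le_of_succ_lt_two_pow (lt_of_le_of_lt hge ht)
  have hk4 : 4 ≤ k := by
    calc 4 = 2 ^ 2 := by norm_num
      _ ≤ 2 ^ t := Nat.pow_le_pow_right (by norm_num) ht2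
  have hk : 1 ≤ k := by omega
  -- division bookkeeping: `k = K q + r`, `r < K`
  set q : ℕ := k / K with hq
  set r : ℕ := k % K with hr
  have F1 : K * q + r = k := Nat.div_add_mod k K
  have F2 : r < K := Nat.mod_lt k hK
  have hsplitA : ((c₀ + 1) * K + c * (E * E) + c₀ * E + 1) * (t + 1) =
      c₀ * (K * (t + 1)) + K * (t + 1) + c * (E * E) * (t + 1) + c₀ * (E * (t + 1)) + (t + 1) := by ring
  rw [hsplitA] at ht
  have F5 : r ≤ K * (t + 1) := F2.le.trans (Nat.le_mul_of_pos_right K (Nat.succ_pos t))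
  have F4 : c₀ * r ≤ c₀ * (K * (t + 1)) := Nat.mul_le_mul_left c₀ F5
  have F6 : K * (c * (E * (t + 1))) ≤ c * (E * E) * (t + 1) := by
    have e : c * (E * E) * (t + 1) = E * (c * (E * (t + 1))) := by ring
    rw [e]; exact Nat.mul_le_mul_right _ hKE
  have F6' : d * (c * (E * (t + 1))) ≤ c * (E * E) * (t + 1) := by
    have e : c * (E * E) * (t + 1) = E * (c * (E * (t + 1))) := by ring
    rw [e]; exact Nat.mul_le_mul_right _ (Nat.le_succ d)
  have F7 : K ≤ K * (t + 1) := Nat.le_mul_of_pos_right K (Nat.succ_pos t)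
  have hB : c * ((d + 1) * (Nat.log 2 k + 1)) < k / K := by
    rw [hlog, ← hE]
    have e0 : c * (E * (t + 1)) = c * (E * (t + 1)) := rfl
    have h8 : K * (c * (E * (t + 1))) < K * q := by
      generalize K * (c * (E * (t + 1))) = a at F6 ⊢
      generalize c * (E * E) * (t + 1) = D₁ at ht F6 F6' ⊢
      generalize K * (t + 1) = δ at ht F5 F7 ⊢
      generalize c₀ * δ = γ at ht
      generalize c₀ * (E * (t + 1)) = D₂ at ht
      generalize K * q = u at F1 ⊢
      omega
    exact Nat.lt_of_mul_lt_mul_left h8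
  obtain ⟨N, hN, h, _, hlb, _, hck⟩ := iterate_levels_easy hweak hk4 hB d le_rfl
  obtain ⟨C, hCO, hCs, hCe⟩ := hck.toCircuit
  have hN1 : 1 ≤ N := by rw [hN]; exact Nat.one_le_pow _ _ hk
  refine ⟨N, hN1, h, C, hCO, fun x => hCe x, k + E * (t + 1), by omega, ?_, fun P hP => ?_⟩
  · -- `N + |C| ≤ k^E (1 + E · univBound k) ≤ 2^(t E) · 2^E · 2^(k+3)`
    have hU : univBound k ≤ 2 ^ (k + 3) :=
      Literature.Computability.MetaComplexity.Hirahara2020.univBound_le_two_pow k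
    have hE2 : E + 1 ≤ 2 ^ E := Nat.lt_two_pow_self
    have hNpow : N = 2 ^ (t * E) := by rw [hN, ← hE, hkdef, ← pow_mul]
    have h1 : N + C.size ≤ N * (1 + E * univBound k) := by
      have eN : N * (1 + E * univBound k) = N + E * (N * univBound k) := by ring
      rw [eN, hE]
      exact Nat.add_le_add_left hCs N
    have h2 : 1 + E * univBound k ≤ 2 ^ E * 2 ^ (k + 3) := by
      have h21 : 1 + E * univBound k ≤ (E + 1) * 2 ^ (k + 3) := by
        have h8 : 1 ≤ 2 ^ (k + 3) := Nat.one_le_two_pow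
        have hdU : E * univBound k ≤ E * 2 ^ (k + 3) := Nat.mul_le_mul_left E hU
        have e : (E + 1) * 2 ^ (k + 3) = E * 2 ^ (k + 3) + 2 ^ (k + 3) := by ring
        rw [e]
        omega
      exact h21.trans (Nat.mul_le_mul_right _ hE2)
    have h3 : N + C.size ≤ 2 ^ (t * E + E + (k + 3)) := by
      rw [pow_add, pow_add, ← hNpow, mul_assoc]
      exact h1.trans (Nat.mul_le_mul_left N h2)
    calc Nat.log 2 (N + C.size) ≤ Nat.log 2 (2 ^ (t * E + E + (k + 3))) := Nat.log_mono_right h3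
      _ = t * E + E + (k + 3) := Nat.log_pow (by norm_num) _
      _ ≤ 4 * (k + E * (t + 1)) := by
          have hX : t * E + E = E * (t + 1) := by ring
          generalize E * (t + 1) = X at hX ⊢
          omega
  · -- depth: `d q ≤ depth + d c E (t+1)`, `d q = c₀ (K q) + K q`, `K q + r = k`, and `ht`
    have h1 := hlb P hP
    rw [hlog, ← hE] at h1
    have e1 : d * q = c₀ * (K * q) + K * q := by rw [hd]; ring
    have e2 : c₀ * (k + E * (t + 1)) = c₀ * (K * q) + c₀ * r + c₀ * (E * (t + 1)) := by
      rw [← F1]; ring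
    rw [e2]
    rw [e1] at h1
    generalize d * (c * (E * (t + 1))) = D₁ at F6' h1
    generalize c * (E * E) * (t + 1) = D₁' at ht F6' F6
    generalize K * (t + 1) = δ at ht F5 F4 F7
    generalize c₀ * δ = γ at ht F4
    generalize c₀ * (E * (t + 1)) = D₂ at ht ⊢
    generalize K * q = u at F1 h1 ⊢
    generalize c₀ * u = α at h1 ⊢
    generalize c₀ * r = β at F4 ⊢
    omega

/-! ### The theorems -/

/-- **Weak KRW for EASY outer functions already gives `P ⊄ NC¹`** (endgame = the landed
`KrwChromaticSteeringCompositionIterationFrac.not_NC1_of_hardFunctions`). -/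
theorem notNC1_of_easyOuterWeakKRWFrac (h : EasyOuterWeakKRWFrac) : ∃ L ∈ Classes.P, L ∉ NC1 := by
  obtain ⟨c, K, hK, hweak⟩ := h
  exact not_NC1_of_hardFunctions fun c₀ => exists_hard_function_of_easyOuterWeakKRWFrac hweak hK c₀

/-- In particular (a second proof of the landed `compositionIterationFrac_holds`): weak KRW at fractional scale
gives `P ⊄ NC¹`. -/
theorem notNC1_of_weakKRWFrac (h : WeakKRWFrac) : ∃ L ∈ Classes.P, L ∉ NC1 :=
  notNC1_of_easyOuterWeakKRWFrac (easyOuterWeakKRWFrac_of_weakKRWFrac h)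

/-! ### The easy-outer DOOR of card `easy-outer-door` (strong game) — its first lemma, proved and simplified -/

/-- VERBATIM `EasyOuterDoor.EasyOuterFrac`: fractional STRONG composition demanded for easy outer `f` only. -/
def EasyOuterFrac : Prop :=
  ∃ c k : ℕ, 0 < k ∧ ∀ m n : ℕ, 1 ≤ n → ∀ f : (Fin m → Bool) → Bool, (∃ a b, f a ≠ f b) →
    EasyOuter f →
    ∃ g : (Fin n → Bool) → Bool, ∀ P : KWTree (Fin m × Fin n), P.SolvesStrong f g →
      ∃ Q : KWTree (Fin m), Q.Solves f ∧ Q.depth + n / k ≤ P.depth + c * (Nat.log 2 (m * n) + 1)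

/-- VERBATIM `EasyOuterDoor.HardSmallOuterFrac` (the "one hard level"; NOT needed below). -/
def HardSmallOuterFrac : Prop :=
  ∀ ch : ℕ, ∃ c : ℕ, ∀ m n : ℕ, 1 ≤ n → m ≤ n → ∀ f : (Fin m → Bool) → Bool, (∃ a b, f a ≠ f b) →
    (∀ Q : KWTree (Fin m), Q.Solves f → m ≤ Nat.log 2 Q.leafCount + ch * (Nat.log 2 m + 1)) →
    ∃ g : (Fin n → Bool) → Bool, ∀ P : KWTree (Fin m × Fin n), P.SolvesStrong f g →
      ∃ Q : KWTree (Fin m), Q.Solves f ∧ Q.depth + n / 26 ≤ P.depth + c * (Nat.log 2 (m * n) + 1)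

/-- VERBATIM `EasyOuterDoor.FormulaHardFunctionsExist` (NOT needed below). -/
def FormulaHardFunctionsExist : Prop :=
  ∃ c : ℕ, ∀ n : ℕ, 1 ≤ n → ∃ g : (Fin n → Bool) → Bool, (∃ a b, g a ≠ g b) ∧
    ∀ Q : KWTree (Fin n), Q.Solves g → n ≤ Nat.log 2 Q.leafCount + c * (Nat.log 2 n + 1)

/-- VERBATIM `EasyOuterDoor.CompositionIterationSplit` (the card's unproved FIRST LEMMA). -/
def CompositionIterationSplit : Prop :=
  HardSmallOuterFrac → EasyOuterFrac → FormulaHardFunctionsExist →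
    Summit.PneNP.PneNP.Theses.KrwChromaticSteering.StandardFromStrong →
      ∃ L ∈ Classes.P, L ∉ NC1

/-- The easy-outer door (strong game) and C2 `StandardFromStrong` give weak KRW for easy outer functions, with
C2's hardest inner function `g₀` as the witness (the route's `weakKRW_of`, relativised to easy `f`). -/
theorem easyOuterWeakKRWFrac_of_easyOuterFrac (h1 : EasyOuterFrac)
    (h2 : Summit.PneNP.PneNP.Theses.KrwChromaticSteering.StandardFromStrong) : EasyOuterWeakKRWFrac := by
  obtain ⟨c₁, k, hk, h1⟩ := h1
  obtain ⟨c₂, h2⟩ := h2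
  refine ⟨c₁ + c₂, k, hk, fun m n hn f hf hE => ?_⟩
  obtain ⟨g₀, hg₀⟩ := h2 m n hn f hf
  obtain ⟨g, hg⟩ := h1 m n hn f hf hE
  refine ⟨g₀, fun P hP => ?_⟩
  obtain ⟨P', hP', hP'd⟩ := hg₀ g P hP
  obtain ⟨Q, hQ, hQd⟩ := hg P' hP'
  refine ⟨Q, hQ, ?_⟩
  have hsplit : (c₁ + c₂) * (Nat.log 2 (m * n) + 1) =
      c₁ * (Nat.log 2 (m * n) + 1) + c₂ * (Nat.log 2 (m * n) + 1) := by ring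
  rw [hsplit]
  omega

/-- **`CompositionIterationSplit` HOLDS** — and uses neither `HardSmallOuterFrac` (Meir's theorem at the one
hard level) nor `FormulaHardFunctionsExist`: the tower started at the dictator has no hard level. -/
theorem compositionIterationSplit_holds : CompositionIterationSplit := fun _ h1 _ h2 =>
  notNC1_of_easyOuterWeakKRWFrac (easyOuterWeakKRWFrac_of_easyOuterFrac h1 h2)

/-- **The easy-outer door decides the sub-problem with C2 and the residual only** (cf. `EasyOuterDoor.closes_easy`,
which additionally took `MeirStrongComposition`, `FormulaHardFunctionsExist` and the unproved
`CompositionIterationSplit`).  Conditional glue; `P ≠ NP` is not proved here. -/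
theorem closes_easy' (h1 : EasyOuterFrac)
    (h2 : Summit.PneNP.PneNP.Theses.KrwChromaticSteering.StandardFromStrong)
    (hR : Summit.PneNP.PneNP.Theses.KrwChromaticSteering.FormulaLayerLift) : PneNP := by
  refine hR fun hsub => ?_
  obtain ⟨L, hLP, hLNC⟩ := notNC1_of_easyOuterWeakKRWFrac (easyOuterWeakKRWFrac_of_easyOuterFrac h1 h2)
  exact hLNC (hsub hLP)

/-- The same from weak KRW for easy outer functions alone (standard game; no C2). -/
theorem closes_easyWeak (h1 : EasyOuterWeakKRWFrac)
    (hR : Summit.PneNP.PneNP.Theses.KrwChromaticSteering.FormulaLayerLift) : PneNP := by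
  refine hR fun hsub => ?_
  obtain ⟨L, hLP, hLNC⟩ := notNC1_of_easyOuterWeakKRWFrac h1
  exact hLNC (hsub hLP)

end Summit.PneNP.PneNP.Cruxes.StrongComposition.EasyOuterIterationFrac
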